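import Mathlib
import Literature.Analysis.FunctionSpaces.TorusTrigPoly
import Literature.Analysis.FunctionSpaces.TorusDirichletKernel
import Literature.Analysis.FunctionSpaces.TorusAxisAverage
import Summits.AnomalousDissipation.AnomalousDissipation.Theorems.TaylorCertificatesPacketLemmaFejer
import HarnessLib

/-!
# Route TaylorCertificates — `PacketLemma`, helper 4: the product Fejér–Jackson envelope on `T^d`

The envelope of the trigonometric packet in the proof of
`Summit.AnomalousDissipation.AnomalousDissipation.Theses.TaylorCertificates.PacketLemma`
(item stmt-AnomalousDissipation-14032) is the real non-negative trigonometric polynomial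

  `ψ(x) = ∏ᵢ |χ_M(xᵢ - x₀ᵢ)|²`,   `χ_M = ∑_{j ≤ M} e_j` (`dirChar`),

centred at `x₀ ∈ T^d`, so that `ψ²` is the product Jackson kernel. This file records, with
`n = M + 1` and `Z = ∫ ψ²`:

* `integral_prod_circle` — Fubini for products of one-variable functions on `T^d`;
* `ofReal_envelope_eq_trigPoly` — `ψ` is the trigonometric polynomial over the cube `Ω_M`
  (`Torus.freqCube M`) with coefficients `α_k = ∏ᵢ #{j-j'=kᵢ} conj e_{kᵢ}(x₀ᵢ)`;
* `integral_envelope_sq_eq`, `integral_envelope_sq_pos`, `le_integral_envelope_sq` —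
  `Z = (∫|χ_M|⁴)^d ≥ (8 n³/π⁴)^d > 0`;
* `integral_envelope_sq_mul_window_le` — the concentration estimate
  `∫ ψ² · |1 - e_1(xᵢ - x₀ᵢ)|²/4 ≤ (π⁴/(8n²)) Z` (from `|χ_M|²|1-e_1|² ≤ 4`, `∫|χ_M|² = n`,
  `∫|χ_M|⁴ ≥ 8n³/π⁴`).

No definitions, no named facts.
-/

noncomputable section

open MeasureTheory UnitAddTorus Complex Real
open scoped ComplexConjugate

namespace Summit.AnomalousDissipation.AnomalousDissipation.Theorems

-- the mandated namespace `Summit.<Summit>.<Problem>.Theorems` repeats `AnomalousDissipation` (single-problem summit)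
set_option linter.dupNamespace false

open Literature.Analysis.FunctionSpaces Literature.Analysis.FunctionSpaces.Torus

variable {d : Type*} [Fintype d]

/-! ### Fubini for product functions on `T^d` -/

/-- **Fubini on the torus for products of one-variable functions**:
`∫_{T^d} ∏ᵢ fᵢ(xᵢ) dx = ∏ᵢ ∫_{T¹} fᵢ`. [folklore] -/
theorem integral_prod_circle (f : d → UnitAddCircle → ℝ) :
    ∫ x : UnitAddTorus d, ∏ i, f i (x i) = ∏ i, ∫ v, f i v := by
  rw [MeasureTheory.volume_pi]
  exact MeasureTheory.integral_fintype_prod_eq_prod (𝕜 := ℝ) f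

/-! ### The envelope as a trigonometric polynomial over the cube -/

omit [Fintype d] in
/-- Characters of the circle on differences: `e_n(u - u₀) = e_n(u) conj e_n(u₀)`. [folklore] -/
theorem fourier_apply_sub (n : ℤ) (u u₀ : UnitAddCircle) :
    fourier n (u - u₀) = fourier n u * conj (fourier n u₀) := by
  rw [sub_eq_add_neg, Torus.fourier_apply_add, ← fourier_neg]
  congr 1
  simp only [fourier_apply, neg_smul, smul_neg]

/-- **The envelope is a trigonometric polynomial over the cube `Ω_M`**:
`∏ᵢ |χ_M(xᵢ - x₀ᵢ)|² = ∑_{k ∈ Ω_M} e_k(x) α_k`, `α_k = ∏ᵢ #{j - j' = kᵢ} conj e_{kᵢ}(x₀ᵢ)`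
(the one-variable expansion `norm_sq_dirChar_eq_sum` multiplied out over the coordinates). [folklore] -/
theorem ofReal_envelope_eq_trigPoly [DecidableEq d] (M : ℕ) (x₀ x : UnitAddTorus d) :
    (((∏ i, ‖dirChar M (x i - x₀ i)‖ ^ 2 : ℝ)) : ℂ) =
      trigPoly (freqCube M) (fun k => ∏ i, ((diffCount M (k i) : ℂ) * conj (fourier (k i) (x₀ i)))) x := by
  rw [Complex.ofReal_prod]
  simp_rw [norm_sq_dirChar_eq_sum, fourier_apply_sub]
  have h : ∀ i, ∑ h ∈ Finset.Icc (-(M : ℤ)) M, (diffCount M h : ℂ) * (fourier h (x i) * conj (fourier h (x₀ i))) =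
      ∑ h ∈ Finset.Icc (-(M : ℤ)) M, ((diffCount M h : ℂ) * conj (fourier h (x₀ i))) * fourier h (x i) := by
    intro i
    exact Finset.sum_congr rfl fun h _ => by ring
  simp_rw [h]
  rw [Finset.prod_univ_sum, trigPoly_apply]
  change ∑ k ∈ freqCube M, _ = _
  refine Finset.sum_congr rfl fun k _ => ?_
  rw [Finset.prod_mul_distrib, smul_eq_mul, mul_comm]
  rfl

/-- The envelope is continuous. [folklore] -/
theorem continuous_envelope (M : ℕ) (x₀ : UnitAddTorus d) :
    Continuous fun x : UnitAddTorus d => ∏ i, ‖dirChar M (x i - x₀ i)‖ ^ 2 := by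
  refine continuous_finsetProd _ fun i _ => ?_
  exact (((continuous_dirChar M).comp ((continuous_apply i).sub continuous_const)).norm).pow 2

/-! ### `L²` mass of the envelope -/

/-- `Z = ∫ ψ² = (∫ |χ_M|⁴)^d` (Fubini and translation invariance on each circle). [folklore] -/
theorem integral_envelope_sq_eq (M : ℕ) (x₀ : UnitAddTorus d) :
    ∫ x : UnitAddTorus d, (∏ i, ‖dirChar M (x i - x₀ i)‖ ^ 2) ^ 2 =
      (∫ v : UnitAddCircle, ‖dirChar M v‖ ^ 4) ^ Fintype.card d := by
  have h : ∀ x : UnitAddTorus d, (∏ i, ‖dirChar M (x i - x₀ i)‖ ^ 2) ^ 2 =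
      ∏ i, ‖dirChar M (x i - x₀ i)‖ ^ 4 := by
    intro x
    rw [← Finset.prod_pow]
    exact Finset.prod_congr rfl fun i _ => by ring
  simp_rw [h]
  have H := integral_prod_circle (d := d) (fun i v => ‖dirChar M (v - x₀ i)‖ ^ 4)
  beta_reduce at H
  rw [H]
  calc ∏ i, ∫ v : UnitAddCircle, ‖dirChar M (v - x₀ i)‖ ^ 4
      = ∏ _i : d, ∫ v : UnitAddCircle, ‖dirChar M v‖ ^ 4 :=
        Finset.prod_congr rfl fun i _ => integral_sub_right_eq_self (fun v => ‖dirChar M v‖ ^ 4) (x₀ i)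
    _ = (∫ v : UnitAddCircle, ‖dirChar M v‖ ^ 4) ^ Fintype.card d := by
        rw [Finset.prod_const, Finset.card_univ]

/-- `Z ≥ (8 (M+1)³/π⁴)^d`. [folklore] -/
theorem le_integral_envelope_sq (M : ℕ) (x₀ : UnitAddTorus d) :
    (8 * (M + 1) ^ 3 / π ^ 4) ^ Fintype.card d ≤
      ∫ x : UnitAddTorus d, (∏ i, ‖dirChar M (x i - x₀ i)‖ ^ 2) ^ 2 := by
  rw [integral_envelope_sq_eq]
  exact pow_le_pow_left₀ (by positivity) (integral_norm_four_dirChar_ge M) _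

/-- `Z > 0`. [folklore] -/
theorem integral_envelope_sq_pos (M : ℕ) (x₀ : UnitAddTorus d) :
    0 < ∫ x : UnitAddTorus d, (∏ i, ‖dirChar M (x i - x₀ i)‖ ^ 2) ^ 2 :=
  lt_of_lt_of_le (by positivity) (le_integral_envelope_sq M x₀)

/-! ### Concentration: the window `|1 - e_1(xᵢ - x₀ᵢ)|²/4 = sin²(π(xᵢ - x₀ᵢ))` -/

/-- **Concentration of the Jackson envelope at its centre**: for each coordinate `i`,
`∫ ψ(x)² |1 - e_1(xᵢ - x₀ᵢ)|²/4 dx ≤ (π⁴ / (8 (M+1)²)) ∫ ψ²`. Pointwise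
`|χ_M|⁴ |1-e_1|²/4 ≤ |χ_M|²` in the `i`-th factor; then Fubini, `∫|χ_M|² = M+1` and
`∫|χ_M|⁴ ≥ 8(M+1)³/π⁴`. [folklore] -/
theorem integral_envelope_sq_mul_window_le [DecidableEq d] (M : ℕ) (x₀ : UnitAddTorus d) (i : d) :
    ∫ x : UnitAddTorus d, (∏ j, ‖dirChar M (x j - x₀ j)‖ ^ 2) ^ 2 *
        (‖(1 : ℂ) - fourier 1 (x i - x₀ i)‖ ^ 2 / 4) ≤
      π ^ 4 / (8 * (M + 1) ^ 2) * ∫ x : UnitAddTorus d, (∏ j, ‖dirChar M (x j - x₀ j)‖ ^ 2) ^ 2 := by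
  classical
  -- the comparison function: `|χ|²` in the `i`-th factor, `|χ|⁴` in the others
  set g : d → UnitAddCircle → ℝ := fun j v =>
    if j = i then ‖dirChar M (v - x₀ j)‖ ^ 2 else ‖dirChar M (v - x₀ j)‖ ^ 4 with hg
  have hpt : ∀ x : UnitAddTorus d, (∏ j, ‖dirChar M (x j - x₀ j)‖ ^ 2) ^ 2 *
      (‖(1 : ℂ) - fourier 1 (x i - x₀ i)‖ ^ 2 / 4) ≤ ∏ j, g j (x j) := by
    intro x
    rw [← Finset.prod_pow, ← Finset.mul_prod_erase Finset.univ _ (Finset.mem_univ i),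
      ← Finset.mul_prod_erase Finset.univ (fun j => g j (x j)) (Finset.mem_univ i)]
    have hrest : ∏ j ∈ Finset.univ.erase i, (‖dirChar M (x j - x₀ j)‖ ^ 2) ^ 2 =
        ∏ j ∈ Finset.univ.erase i, g j (x j) := by
      refine Finset.prod_congr rfl fun j hj => ?_
      simp only [hg, if_neg (Finset.ne_of_mem_erase hj)]; ring
    rw [hrest, mul_assoc, mul_comm (∏ j ∈ Finset.univ.erase i, g j (x j)), ← mul_assoc]
    refine mul_le_mul_of_nonneg_right ?_ (Finset.prod_nonneg fun j _ => by
      simp only [hg]; split_ifs <;> positivity)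
    simp only [hg, if_true]
    have h4 := norm_sq_dirChar_mul_le M (x i - x₀ i)
    nlinarith [sq_nonneg ‖dirChar M (x i - x₀ i)‖]
  have hint_g : ∫ x : UnitAddTorus d, ∏ j, g j (x j) =
      (M + 1) * ∏ j ∈ Finset.univ.erase i, ∫ v : UnitAddCircle, ‖dirChar M v‖ ^ 4 := by
    rw [integral_prod_circle, ← Finset.mul_prod_erase Finset.univ _ (Finset.mem_univ i)]
    congr 1
    · simp only [hg, if_true]
      rw [MeasureTheory.integral_sub_right_eq_self (fun v => ‖dirChar M v‖ ^ 2), integral_norm_sq_dirChar]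
    · refine Finset.prod_congr rfl fun j hj => ?_
      simp only [hg, if_neg (Finset.ne_of_mem_erase hj)]
      exact MeasureTheory.integral_sub_right_eq_self (fun v => ‖dirChar M v‖ ^ 4) _
  have hZ : ∫ x : UnitAddTorus d, (∏ j, ‖dirChar M (x j - x₀ j)‖ ^ 2) ^ 2 =
      (∫ v : UnitAddCircle, ‖dirChar M v‖ ^ 4) * ∏ j ∈ Finset.univ.erase i, ∫ v : UnitAddCircle, ‖dirChar M v‖ ^ 4 := by
    rw [integral_envelope_sq_eq, ← Finset.card_univ, ← Finset.prod_const,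
      ← Finset.mul_prod_erase Finset.univ _ (Finset.mem_univ i)]
  -- integrate the pointwise bound
  have hcont : Continuous fun x : UnitAddTorus d => ∏ j, g j (x j) := by
    refine continuous_finsetProd _ fun j _ => ?_
    simp only [hg]
    split_ifs
    · exact (((continuous_dirChar M).comp ((continuous_apply j).sub continuous_const)).norm).pow 2
    · exact (((continuous_dirChar M).comp ((continuous_apply j).sub continuous_const)).norm).pow 4
  have hcontL : Continuous fun x : UnitAddTorus d => (∏ j, ‖dirChar M (x j - x₀ j)‖ ^ 2) ^ 2 *
      (‖(1 : ℂ) - fourier 1 (x i - x₀ i)‖ ^ 2 / 4) := by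
    refine ((continuous_envelope M x₀).pow 2).mul ?_
    refine (Continuous.pow ?_ 2).div_const _
    exact (continuous_const.sub ((fourier 1).continuous.comp ((continuous_apply i).sub continuous_const))).norm
  calc ∫ x : UnitAddTorus d, (∏ j, ‖dirChar M (x j - x₀ j)‖ ^ 2) ^ 2 * (‖(1 : ℂ) - fourier 1 (x i - x₀ i)‖ ^ 2 / 4)
      ≤ ∫ x : UnitAddTorus d, ∏ j, g j (x j) :=
        integral_mono hcontL.integrable_unitAddTorus hcont.integrable_unitAddTorus hpt
    _ = (M + 1) * ∏ j ∈ Finset.univ.erase i, ∫ v : UnitAddCircle, ‖dirChar M v‖ ^ 4 := hint_g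
    _ ≤ (π ^ 4 / (8 * (M + 1) ^ 2) * ∫ v : UnitAddCircle, ‖dirChar M v‖ ^ 4) *
          ∏ j ∈ Finset.univ.erase i, ∫ v : UnitAddCircle, ‖dirChar M v‖ ^ 4 := by
        refine mul_le_mul_of_nonneg_right ?_ (Finset.prod_nonneg fun j _ =>
          integral_nonneg fun v => by simp only [Pi.zero_apply]; positivity)
        have hJ := integral_norm_four_dirChar_ge M
        have hM : (0 : ℝ) < M + 1 := by positivity
        -- `(M+1) ≤ (π⁴/(8(M+1)²)) J` since `J ≥ 8(M+1)³/π⁴`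
        have h1 : π ^ 4 / (8 * (M + 1) ^ 2) * (8 * (M + 1) ^ 3 / π ^ 4) = (M + 1 : ℝ) := by
          field_simp
        have h2 : (0 : ℝ) ≤ π ^ 4 / (8 * (M + 1) ^ 2) := by positivity
        calc (M + 1 : ℝ) = π ^ 4 / (8 * (M + 1) ^ 2) * (8 * (M + 1) ^ 3 / π ^ 4) := h1.symm
          _ ≤ π ^ 4 / (8 * (M + 1) ^ 2) * ∫ v : UnitAddCircle, ‖dirChar M v‖ ^ 4 :=
            mul_le_mul_of_nonneg_left hJ h2
    _ = π ^ 4 / (8 * (M + 1) ^ 2) * ∫ x : UnitAddTorus d, (∏ j, ‖dirChar M (x j - x₀ j)‖ ^ 2) ^ 2 := by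
        rw [hZ]; ring

end Summit.AnomalousDissipation.AnomalousDissipation.Theorems
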